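import Summits.ResolutionOfSingularities.ResolutionOfSingularities.Theorems.EquisingularLiftEquisingularLiftNatIsoHypPointOfSingularPointsLinAut
import Summits.ResolutionOfSingularities.ResolutionOfSingularities.Theorems.EquisingularLiftEquisingularLiftNatBlowupProductRegular
import Summits.ResolutionOfSingularities.ResolutionOfSingularities.Theorems.EquisingularLiftEquisingularLiftBlowupModelTransport
import Literature.AlgebraicGeometry.Resolution.BoundarySplitting
import HarnessLib

/-!
# Crux `EquisingularLift` (stmt-ResolutionOfSingularities-15660): the OPEN residual's conclusion — a regular blow-up model — for every hypersurface whose singular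
# points are finitely many ONE-STEP points IN ARBITRARY POSITION (every field, dimension, characteristic)

[OURS · leafhand-res-equisingularlift-10 g0, 2026-08-31; cell `pub/decomp-res`] AI-produced, weaker than expert review; NOT a statement of any manuscript; nothing
here proves resolution of singularities in positive characteristic.  DEF-FREE helper, `--supports stmt-…-15660`; no `sorry`; standard axioms; ZERO named hypotheses.

The 15660-currency twin of ✓ `isoHypPoint_of_singularOneStepPoints_linAut` (p829768).  lh9's ✓ `StrataSplit.blowupModel_firstOrderPoints` / lh7's
✓ `blowupModel_ordinaryPoints` blow up ONE product of VERTEX points (≤ `n + 1` points in linearly general position).  With the intrinsic one-step property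
transported to arbitrary points (✓ `oneStepAt_of_linAut`, p829617) the product may run over ANY finite set of closed points:

* ★★ `blowupModel_of_oneStepPoints` — **ABSTRACT**: `H` integral, its non-regular points a finite set `S` of closed ONE-STEP points (intrinsic), a point `ξ` off `S`
  ⟹ `∃ 𝔞 ≠ ⊥` on `H` (namely `Π_{x∈S} 𝔪_x`) all of whose blow-ups are regular (✓ `MultiCentre.isRegular_of_prod`: disjoint centres, each resolved pointwise,
  local isomorphism elsewhere ✓ `IsBlowup.isIso_stalkMap_of_not_mem_support`; `≠ ⊥` because `ξ ∉ supp`);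
* ★★★ `StrataSplit.blowupModel_oneStepPoints_linAut` — **EXPLICIT, EVERY FIELD**: `F` a prime form; finitely many points each with its own linear
  coordinates `(g, c)` in which the moved equation `linSubst ↑g⁻¹ F` is a prime form carrying seat res-D-pv-013's ONE-STEP datum at the vertex `P_c`; `V₊(F)`
  regular off these points ⟹ `V₊(F)` has a regular blow-up model — the conclusion of `stub_blowupModel_ge_five` at these `H`, in every dimension `n`;
* ★ `StrataSplit.blowupModel_of_range_eq_oneStepPoints_linAut` — the same for every binder `(H, ι)` of the crux with `range ι = V₊(F)` (✓ `blowupModel_of_range_eq`).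

Honest label: instances of the open residual's CONCLUSION; `stub_blowupModel_ge_five` (= resolution over `k̄` in dimension `≥ 4`) stays OPEN; no registered stub closed.

References: [Hartshorne1977, I Thm. 5.1, II Example 7.1.1, II Ex. 7.12]; [StacksProject, Tags 080A, 0804] — through the cited tree files.
-/

set_option linter.dupNamespace false -- mandated namespace `Summit.<Summit>.<Problem>` of this single-conjunct summit

noncomputable section

open CategoryTheory CategoryTheory.Limits AlgebraicGeometry TopologicalSpace
open MvPolynomial HomogeneousLocalization
open Literature.AlgebraicGeometry.Resolution Literature.AlgebraicGeometry.Motives Literature.AlgebraicGeometry.GroupSchemes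
open Literature.AlgebraicGeometry.Motives.SmoothHypersurface Literature.AlgebraicGeometry.Motives.ProjectiveSpace
open AlgebraicGeometry.Scheme.IdealSheafData

namespace Summit.ResolutionOfSingularities.ResolutionOfSingularities.Cruxes.EquisingularLiftNat.Sections

/-! ## The abstract regular blow-up model: blow up all the one-step points at once -/

/-- ★★ **FINITELY MANY ONE-STEP SINGULAR POINTS ⟹ A REGULAR BLOW-UP MODEL** (the currency of crux `EquisingularLift`'s open residual
`stub_blowupModel_ge_five`), abstract and position-free: `H` integral, its non-regular points a finite set `S` of closed one-step points (intrinsic sense), `ξ` a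
point off `S` ⟹ `H` carries a non-zero ideal sheaf — `Π_{x ∈ S} 𝔪_x` — ALL of whose blow-ups are regular (✓ `MultiCentre.isRegular_of_prod`: blow-ups along a
product of ideals with disjoint supports are regular where the factors' blow-ups are). [OURS] [cite: StacksProject, Tag 080A] -/
theorem blowupModel_of_oneStepPoints {H : Scheme.{0}} [IsIntegral H] (S : Finset H)
    (hcl : ∀ x ∈ S, IsClosed ({x} : Set H))
    (hreg : ∀ x : H, x ∉ S → IsRegularLocalRing (H.presheaf.stalk x))
    (hone : ∀ x ∈ S, ∀ (hx : IsClosed ({x} : Set H)) (Z : Scheme.{0}) (τ : Z ⟶ H),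
      IsBlowup τ (vanishingIdeal ⟨{x}, hx⟩) → ∀ z : Z, τ z = x → IsRegularLocalRing (Z.presheaf.stalk z))
    (ξ : H) (hξ : ∀ x ∈ S, x ≠ ξ) :
    ∃ 𝔞 : H.IdealSheafData, 𝔞 ≠ ⊥ ∧ ∀ (Z : Scheme.{0}) (π : Z ⟶ H), IsBlowup π 𝔞 → Scheme.IsRegular Z := by
  classical
  let pt : {x // x ∈ S} → H.IdealSheafData := fun x => vanishingIdeal ⟨{x.1}, hcl x.1 x.2⟩
  let L : List H.IdealSheafData := S.attach.toList.map pt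
  have hsuppt : ∀ x : {x // x ∈ S}, ((pt x).support : Set H) = {x.1} := fun x => Scheme.IdealSheafData.coe_support_vanishingIdeal _
  have hmemL : ∀ I, I ∈ L → ∃ x : {x // x ∈ S}, pt x = I := fun I hI => by
    obtain ⟨x, -, h⟩ := List.mem_map.mp hI; exact ⟨x, h⟩
  have hsuppL : (L.prod.support : Set H) ⊆ {x | x ∈ S} := by
    rw [IdealSheafData.coe_support_prod]
    intro y hy
    obtain ⟨I, hI, hyI⟩ := Set.mem_iUnion₂.mp hy
    obtain ⟨x, rfl⟩ := hmemL I hI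
    rw [hsuppt, Set.mem_singleton_iff] at hyI
    rw [hyI]; exact x.2
  refine ⟨L.prod, fun h => ?_, fun Z π hπ => ?_⟩
  · -- `ξ ∉ supp`, so the product is not `⊥`
    have hξmem : ξ ∈ (L.prod.support : Set H) := by rw [h, Scheme.IdealSheafData.support_bot]; trivial
    exact hξ ξ (hsuppL hξmem) rfl
  · refine MultiCentre.isRegular_of_prod L ?_ ?_ (fun x hx => hreg x (fun hxS => hx ?_)) hπ
    · -- pairwise disjoint supports
      refine List.Pairwise.map _ (fun (a b : {x // x ∈ S}) (hab : a ≠ b) => ?_) ((S.attach.nodup_toList).pairwise_of_forall_ne (fun a _ b _ h => h))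
      rw [hsuppt, hsuppt, Set.disjoint_singleton]
      exact fun h => hab (Subtype.ext h)
    · -- each factor: resolved pointwise over its point; a local isomorphism elsewhere
      intro I hI X₁ τ₁ hτ₁ z hz
      obtain ⟨x, rfl⟩ := hmemL I hI
      by_cases hzx : τ₁ z = x.1
      · exact hone x.1 x.2 (hcl x.1 x.2) X₁ τ₁ hτ₁ z hzx
      · have hzs : τ₁ z ∉ ((pt x).support : Set H) := by rw [hsuppt]; exact hzx
        rcases hz with hz | hz
        · exact absurd hz hzs
        · haveI := IsBlowup.isIso_stalkMap_of_not_mem_support hτ₁ hzs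
          haveI : IsRegularLocalRing (H.presheaf.stalk (τ₁ z)) := hz
          exact IsRegularLocalRing.of_ringEquiv (R := H.presheaf.stalk (τ₁ z)) (asIso (τ₁.stalkMap z)).commRingCatIsoToRingEquiv
    · -- points of `S` lie in the support
      rw [IdealSheafData.coe_support_prod]
      refine Set.mem_iUnion₂.mpr ⟨pt ⟨x, hxS⟩, List.mem_map.mpr ⟨⟨x, hxS⟩, Finset.mem_toList.mpr (Finset.mem_attach _ _), rfl⟩, ?_⟩
      rw [hsuppt]; rfl

end Summit.ResolutionOfSingularities.ResolutionOfSingularities.Cruxes.EquisingularLiftNat.Sections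

/-! ## Crux `EquisingularLift` (stmt-ResolutionOfSingularities-15660): the open residual's conclusion for one-step points in arbitrary position -/

namespace Summit.ResolutionOfSingularities.ResolutionOfSingularities.Cruxes.EquisingularLift.StrataSplit

open Summit.ResolutionOfSingularities.ResolutionOfSingularities.Cruxes.EquisingularLiftNat.Sections

/-- ★★★ **ONE-STEP SINGULAR POINTS IN ARBITRARY POSITION ⟹ A REGULAR BLOW-UP MODEL** — EVERY field, dimension, characteristic, any number of points: `F` a
prime form over a field `K`; `pts` per-point linear coordinates `(g, c)` in which the moved equation `linSubst ↑g⁻¹ F` is a prime form of degree `d` carrying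
seat res-D-pv-013's ONE-STEP datum at the vertex `P_c`; `V₊(F)` regular off the points `α_g⁻¹(P_c)`.  Then `V₊(F)` carries a non-zero ideal sheaf all of whose
blow-ups are regular — the conclusion of the open residual `stub_blowupModel_ge_five` of crux `EquisingularLift` at these `H` (✓ `blowupModel_of_oneStepPoints`
with ✓ `oneStepAt_of_linAut`, ✓ `exists_linAutPoint`). [OURS] [cite: Hartshorne1977, I Thm. 5.1, II Example 7.1.1, II Ex. 7.12] [cite: StacksProject, Tag 080A] -/
theorem blowupModel_oneStepPoints_linAut (K : Type) [Field K] {m : ℕ} (F : MvPolynomial (Fin (m + 2 + 1)) K) {d : ℕ}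
    (hF : F.IsHomogeneous d) (hFp : Prime F) (pts : List (GL (Fin (m + 2 + 1)) K × Fin (m + 2 + 1)))
    (hone : ∀ gc ∈ pts,
      (ProjLinAction.linSubst K ((gc.1⁻¹ : GL (Fin (m + 2 + 1)) K) : Matrix (Fin (m + 2 + 1)) (Fin (m + 2 + 1)) K) F).IsHomogeneous d ∧
      Prime (ProjLinAction.linSubst K ((gc.1⁻¹ : GL (Fin (m + 2 + 1)) K) : Matrix (Fin (m + 2 + 1)) (Fin (m + 2 + 1)) K) F) ∧
      ∃ (μ : ℕ) (Φ Ψ : MvPolynomial (Fin (m + 2)) K), 1 ≤ μ ∧ Φ.IsHomogeneous μ ∧ Φ ≠ 0 ∧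
        Ψ ∈ Ideal.span (Set.range (X : Fin (m + 2) → MvPolynomial (Fin (m + 2)) K)) ^ (μ + 1) ∧
        ProjectiveSpace.dehomogenize K gc.2 (ProjLinAction.linSubst K ((gc.1⁻¹ : GL (Fin (m + 2 + 1)) K) :
          Matrix (Fin (m + 2 + 1)) (Fin (m + 2 + 1)) K) F) = Φ + Ψ ∧
        ∀ l : Fin (m + 2), ∃ G : MvPolynomial (Fin (m + 2)) K,
          aeval (fun j => X l * Function.update (X : Fin (m + 2) → MvPolynomial (Fin (m + 2)) K) l 1 j) (Φ + Ψ) = X l ^ μ * G ∧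
          ∀ P : Ideal (MvPolynomial (Fin (m + 2)) K), P.IsPrime → (X l : MvPolynomial (Fin (m + 2)) K) ∈ P → G ∈ P → ∃ j, pderiv j G ∉ P)
    (hreg : letI := MvPolynomial.gradedAlgebra (σ := Fin (m + 2 + 1)) (R := K)
      ∀ x : ↥(hypersurface F).left, (∀ gc ∈ pts, ¬ (∀ a : Fin (m + 2 + 1), a ≠ gc.2 →
        ProjLinAction.linSubst K (gc.1 : Matrix (Fin (m + 2 + 1)) (Fin (m + 2 + 1)) K) (X a) ∈ ((hypersurfaceι F).left x).asHomogeneousIdeal)) →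
        IsRegularLocalRing ((hypersurface F).left.presheaf.stalk x)) :
    letI := MvPolynomial.gradedAlgebra (σ := Fin (m + 2 + 1)) (R := K)
    ∃ 𝔞 : ((hypersurface F).left).IdealSheafData, 𝔞 ≠ ⊥ ∧
      ∀ (Z : Scheme.{0}) (π : Z ⟶ (hypersurface F).left), IsBlowup π 𝔞 → Scheme.IsRegular Z := by
  letI := MvPolynomial.gradedAlgebra (σ := Fin (m + 2 + 1)) (R := K)
  classical
  haveI := HypersurfaceSpecimen.isIntegral_hypersurface_of_prime K F hF hFp
  have hιinj : Function.Injective (hypersurfaceι F).left := (hypersurfaceι F).left.isClosedEmbedding.injective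
  have hpt : ∀ gc, gc ∈ pts → ∃ x : ↥(hypersurface F).left,
      (∀ a : Fin (m + 2 + 1), a ≠ gc.2 → ProjLinAction.linSubst K (gc.1 : Matrix (Fin (m + 2 + 1)) (Fin (m + 2 + 1)) K) (X a) ∈
        ((hypersurfaceι F).left x).asHomogeneousIdeal) ∧
      (∀ x' : ↥(hypersurface F).left, (∀ a : Fin (m + 2 + 1), a ≠ gc.2 →
        ProjLinAction.linSubst K (gc.1 : Matrix (Fin (m + 2 + 1)) (Fin (m + 2 + 1)) K) (X a) ∈ ((hypersurfaceι F).left x').asHomogeneousIdeal) → x' = x) ∧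
      IsClosed ({(hypersurfaceι F).left x} : Set (projectiveSpace (m + 2) K).left) ∧ IsClosed ({x} : Set ↥(hypersurface F).left) := by
    intro gc hgc
    obtain ⟨hF', -, μ, Φ, Ψ, hμ, hΦ, -, hΨ, hdeh, -⟩ := hone gc hgc
    exact exists_linAutPoint K F gc.1 gc.2 hF' ⟨μ, Φ, Ψ, hμ, hΦ, hΨ, hdeh⟩
  choose xpt hxv hxuniq hxcl hxcl' using hpt
  let SH : Finset ↥(hypersurface F).left := pts.toFinset.attach.image (fun gc => xpt gc.1 (List.mem_toFinset.mp gc.2))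
  have hmemSH : ∀ x, x ∈ SH → ∃ (gc : GL (Fin (m + 2 + 1)) K × Fin (m + 2 + 1)) (hgc : gc ∈ pts), xpt gc hgc = x := fun x hx => by
    obtain ⟨gc, -, h⟩ := Finset.mem_image.mp hx
    exact ⟨gc.1, List.mem_toFinset.mp gc.2, h⟩
  have hmemSH' : ∀ gc (hgc : gc ∈ pts), xpt gc hgc ∈ SH := fun gc hgc =>
    Finset.mem_image.mpr ⟨⟨gc, List.mem_toFinset.mpr hgc⟩, Finset.mem_attach _ _, rfl⟩
  obtain ⟨ξ, hξ⟩ : ∃ ξ : ↥(hypersurface F).left, (hypersurfaceι F).left ξ = pointOfPrime F hF hFp := by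
    have h : (pointOfPrime F hF hFp : Proj (homogeneousSubmodule (Fin (m + 2 + 1)) K)) ∈ Set.range (hypersurfaceι F).left := by
      refine (Set.ext_iff.mp (range_hypersurfaceι F) _).mpr ((ProjectiveSpectrum.mem_zeroLocus _ _ _).mpr (Set.singleton_subset_iff.mpr ?_))
      exact Ideal.subset_span rfl
    exact h
  refine blowupModel_of_oneStepPoints SH (fun x hx => ?_) (fun x hx => ?_) (fun x hx hxcl₀ Z τ hτ z hz => ?_) ξ (fun x hx h => ?_)
  · obtain ⟨gc, hgc, rfl⟩ := hmemSH x hx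
    exact hxcl' gc hgc
  · refine hreg x fun gc hgc h => hx ?_
    rw [hxuniq gc hgc x h]
    exact hmemSH' gc hgc
  · obtain ⟨gc, hgc, rfl⟩ := hmemSH x hx
    obtain ⟨hF', hF'p, hone'⟩ := hone gc hgc
    exact oneStepAt_of_linAut K F hF hFp gc.1 gc.2 hF' hF'p hone' _ (hxv gc hgc) hxcl₀ Z τ hτ z hz
  · obtain ⟨gc, hgc, rfl⟩ := hmemSH x hx
    obtain ⟨-, hF'p, -⟩ := hone gc hgc
    obtain ⟨a, hac, ha⟩ := MultiOrd.exists_X_ne_not_mem_span K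
      (ProjLinAction.linSubst K ((gc.1⁻¹ : GL (Fin (m + 2 + 1)) K) : Matrix (Fin (m + 2 + 1)) (Fin (m + 2 + 1)) K) F) hF'p gc.2
    apply ha
    have h1 := hxv gc hgc a hac
    rw [h, hξ] at h1
    change ProjLinAction.linSubst K (gc.1 : Matrix (Fin (m + 2 + 1)) (Fin (m + 2 + 1)) K) (X a) ∈ Ideal.span {F} at h1
    obtain ⟨r, hr⟩ := Ideal.mem_span_singleton'.mp h1
    have h2 := congrArg (ProjLinAction.linSubst K ((gc.1⁻¹ : GL (Fin (m + 2 + 1)) K) : Matrix (Fin (m + 2 + 1)) (Fin (m + 2 + 1)) K)) hr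
    rw [map_mul] at h2
    have h3 : ProjLinAction.linSubst K ((gc.1⁻¹ : GL (Fin (m + 2 + 1)) K) : Matrix (Fin (m + 2 + 1)) (Fin (m + 2 + 1)) K)
        (ProjLinAction.linSubst K (gc.1 : Matrix (Fin (m + 2 + 1)) (Fin (m + 2 + 1)) K) (X a)) = X a := by
      have h := QuadricELNat.linSubst_linSubst_inv gc.1⁻¹ (X a : MvPolynomial (Fin (m + 2 + 1)) K)
      rwa [inv_inv] at h
    rw [h3] at h2
    exact Ideal.mem_span_singleton'.mpr ⟨_, h2⟩

/-- ★ **The same for every binder `(H, ι)` of crux `EquisingularLift` with `range ι = V₊(F)`** (regular blow-up models are intrinsic, ✓ `blowupModel_of_range_eq`).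
[OURS] [cite: Hartshorne1977, II Ex. 7.12] -/
theorem blowupModel_of_range_eq_oneStepPoints_linAut (K : Type) [Field K] {m : ℕ} (F : MvPolynomial (Fin (m + 2 + 1)) K) {d : ℕ}
    (hF : F.IsHomogeneous d) (hFp : Prime F) (pts : List (GL (Fin (m + 2 + 1)) K × Fin (m + 2 + 1)))
    (hone : ∀ gc ∈ pts,
      (ProjLinAction.linSubst K ((gc.1⁻¹ : GL (Fin (m + 2 + 1)) K) : Matrix (Fin (m + 2 + 1)) (Fin (m + 2 + 1)) K) F).IsHomogeneous d ∧
      Prime (ProjLinAction.linSubst K ((gc.1⁻¹ : GL (Fin (m + 2 + 1)) K) : Matrix (Fin (m + 2 + 1)) (Fin (m + 2 + 1)) K) F) ∧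
      ∃ (μ : ℕ) (Φ Ψ : MvPolynomial (Fin (m + 2)) K), 1 ≤ μ ∧ Φ.IsHomogeneous μ ∧ Φ ≠ 0 ∧
        Ψ ∈ Ideal.span (Set.range (X : Fin (m + 2) → MvPolynomial (Fin (m + 2)) K)) ^ (μ + 1) ∧
        ProjectiveSpace.dehomogenize K gc.2 (ProjLinAction.linSubst K ((gc.1⁻¹ : GL (Fin (m + 2 + 1)) K) :
          Matrix (Fin (m + 2 + 1)) (Fin (m + 2 + 1)) K) F) = Φ + Ψ ∧
        ∀ l : Fin (m + 2), ∃ G : MvPolynomial (Fin (m + 2)) K,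
          aeval (fun j => X l * Function.update (X : Fin (m + 2) → MvPolynomial (Fin (m + 2)) K) l 1 j) (Φ + Ψ) = X l ^ μ * G ∧
          ∀ P : Ideal (MvPolynomial (Fin (m + 2)) K), P.IsPrime → (X l : MvPolynomial (Fin (m + 2)) K) ∈ P → G ∈ P → ∃ j, pderiv j G ∉ P)
    (hreg : letI := MvPolynomial.gradedAlgebra (σ := Fin (m + 2 + 1)) (R := K)
      ∀ x : ↥(hypersurface F).left, (∀ gc ∈ pts, ¬ (∀ a : Fin (m + 2 + 1), a ≠ gc.2 →
        ProjLinAction.linSubst K (gc.1 : Matrix (Fin (m + 2 + 1)) (Fin (m + 2 + 1)) K) (X a) ∈ ((hypersurfaceι F).left x).asHomogeneousIdeal)) →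
        IsRegularLocalRing ((hypersurface F).left.presheaf.stalk x))
    {H : Scheme.{0}} (ι : H ⟶ (projectiveSpace (m + 2) K).left) [IsClosedImmersion ι] [IsIntegral H]
    (hrange : letI := MvPolynomial.gradedAlgebra (σ := Fin (m + 2 + 1)) (R := K)
      Set.range ι = {x : Proj (homogeneousSubmodule (Fin (m + 2 + 1)) K) | F ∈ x.asHomogeneousIdeal}) :
    ∃ 𝔞 : H.IdealSheafData, 𝔞 ≠ ⊥ ∧ ∀ (Z : Scheme.{0}) (π : Z ⟶ H), IsBlowup π 𝔞 → Scheme.IsRegular Z :=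
  blowupModel_of_range_eq ι F hF hFp hrange (blowupModel_oneStepPoints_linAut K F hF hFp pts hone hreg)

end Summit.ResolutionOfSingularities.ResolutionOfSingularities.Cruxes.EquisingularLift.StrataSplit

end
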